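import Mathlib

/-!
# Route `LacunarySymmetroid` — crux `DoorA26` (stmt-ValiantsHypothesis-19979): the SECANCY–INFLECTION LEMMA
# (three collinear points on a graph-like arc of a curve force an inflection between them; four force two)

HONEST FRAMING.  Cell `pub-symmetroid`, seat `val-sym-door-p4` (gen 12); helper file `--supports stmt-ValiantsHypothesis-19979`
(`DoorA26 = PosRootLawAt 2 6 19`, OPEN, typed, never asserted here).  Companion of `…DoorA26GraftInflectionBudget` (p689485: the
inflection fewnomial `det[W; θW; θ²W]` of the letter curve and its Descartes budget `< C(K,3)`).  This file is the ROOT-SIDE half of the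
dictionary: an elementary real-analysis lemma (Rolle twice), all supports, all formats — in fact for arbitrary differentiable scalar
functions.

THE LEMMA.  Let `A, B, H : ℝ → ℝ` be twice differentiable (derivatives `A', A''`, … given as functions with `HasDerivAt` everywhere).
On `[x₁, x₃]` assume `A ≠ 0` and the Wronskian `A·B' − A'·B ≠ 0` («GRAPH-LIKE ARC»: in the affine chart `A ≠ 0` the coordinate `B/A` is
monotone).  Then
* `exists_wronskian_eq_zero` — Rolle for a quotient: `H(a) = H(b) = 0` ⇒ `A·H' − A'·H` vanishes in `(a,b)`;
* `exists_det3_eq_zero_of_three_zeros` — **three zeros `x₁ < x₂ < x₃` of `H` force a zero of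
  `det[(A,B,H); (A',B',H'); (A'',B'',H'')]` in `(x₁,x₃)`**;
* `exists_two_det3_eq_zero_of_four_zeros` — four zeros force two distinct zeros.
Mechanism: Rolle on `H/A` gives zeros `c₁ < c₂` of `ω_H = A H' − A' H`; Rolle on `ω_H/ω` (`ω = A B' − A' B`) gives a zero of
`ω·ω_H' − ω'·ω_H`, and the IDENTITY `ω·ω_H' − ω'·ω_H = A · det[(A,B,H);(A',B',H');(A'',B'',H'')]` (`wronskian_identity`, `ring`).

READING (letter curves; why this is filed under door A).  For a curve `W : ℝ → ℝ³` and a basis of linear functionals `(α, β, η)`,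
take `A = α∘W`, `B = β∘W`, `H = η∘W`: the determinant above is `det(α,β,η) · det(W, W', W'')`, whose zeros are the INFLECTIONS of the
projective curve `[W]` (`det3_comp_linear`), and the zeros of `H` are the intersections of `[W]` with the line `{η = 0}`.  So: on an arc
of the letter curve that is graph-like in some affine chart, a line meeting the arc THREE times forces an inflection on the arc, FOUR
times forces two (`exists_inflection_of_three_collinear`, `exists_two_inflections_of_four_collinear`).  In the graft reading of the
located census (memo DOOR-A26-P4G12-REPORT.md, evidence on 19979; located, not asserted): the number `γ` of external roots a graft
letter with Minkowski vector `w` can convert at an end equals the number of intersections of the line `w^⊥` with the END ARC of the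
letter curve beyond the root span, so `γ ≥ 3` needs an end-arc inflection and `γ = 4` (the only ladder route from a `(2,5)` fourteen to
a `(2,6)` twenty) needs two — and no located `(2,5)` row has two.

Nothing here bears on `DoorA26` / `DoorA34` (OPEN), the registers, `MatrixDescartes` (stmt-ValiantsHypothesis-18050) or `VP ≠ VNP`.
No `def`, no `sorry`; axioms standard.  [folklore] Rolle's theorem; the Wronskian identity is a polynomial identity (`ring`).
-/

-- `Summit.ValiantsHypothesis.ValiantsHypothesis.…` repeats a component by the D-0017 layout
-- (single-conjunct summit), which the `dupNamespace` linter flags; the name is mandated.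
set_option linter.dupNamespace false

namespace Summit.ValiantsHypothesis.ValiantsHypothesis.Theorems.LacunarySymmetroid.DoorA26.Inflection

open Set

/-! ### 1. Rolle for a quotient: a zero of the Wronskian `A H' − A' H` between two zeros of `H` -/

/-- **Rolle for a quotient.**  If `H(a) = H(b) = 0` (`a < b`), `A ≠ 0` on `[a,b]`, and `A, H` are differentiable with derivatives
`A', H'`, then the Wronskian `A·H' − A'·H` vanishes somewhere in `(a,b)` (Rolle's theorem for `H/A`). [folklore] -/
theorem exists_wronskian_eq_zero {A H A' H' : ℝ → ℝ} {a b : ℝ} (hab : a < b)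
    (hA : ∀ x, HasDerivAt A (A' x) x) (hH : ∀ x, HasDerivAt H (H' x) x)
    (hA0 : ∀ x ∈ Icc a b, A x ≠ 0) (ha : H a = 0) (hb : H b = 0) :
    ∃ c ∈ Ioo a b, A c * H' c - A' c * H c = 0 := by
  have hcont : ContinuousOn (fun y => H y / A y) (Icc a b) := fun x hx =>
    ((hH x).continuousAt.div (hA x).continuousAt (hA0 x hx)).continuousWithinAt
  have hends : (fun y => H y / A y) a = (fun y => H y / A y) b := by simp [ha, hb]
  obtain ⟨c, hc, hc'⟩ := exists_hasDerivAt_eq_zero (f := fun y => H y / A y)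
    (f' := fun x => (H' x * A x - H x * A' x) / (A x) ^ 2) hab hcont hends
    (fun x hx => (hH x).div (hA x) (hA0 x (Ioo_subset_Icc_self hx)))
  refine ⟨c, hc, ?_⟩
  have hAc : A c ≠ 0 := hA0 c (Ioo_subset_Icc_self hc)
  have hnum : H' c * A c - H c * A' c = 0 := by
    rcases div_eq_zero_iff.mp hc' with h | h
    · exact h
    · exact absurd ((pow_eq_zero_iff two_ne_zero).mp h) hAc
  linarith [hnum, mul_comm (H' c) (A c), mul_comm (H c) (A' c)]

/-! ### 2. The Wronskian identity and the three-zeros lemma -/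

/-- **The Wronskian identity** (a polynomial identity in twelve indeterminates):
`(A B' − A' B)·(A H'' − A'' H) − (A B'' − A'' B)·(A H' − A' H) = A · det[(A,B,H); (A',B',H'); (A'',B'',H'')]`. [folklore] -/
theorem wronskian_identity (A A' A'' B B' B'' H H' H'' : ℝ) :
    (A * B' - A' * B) * (A * H'' - A'' * H) - (A * B'' - A'' * B) * (A * H' - A' * H) =
      A * (A * (B' * H'' - H' * B'') - B * (A' * H'' - H' * A'') + H * (A' * B'' - B' * A'')) := by
  ring

/-- **SECANCY–INFLECTION LEMMA (three points).**  `A, B, H` twice differentiable; on `[x₁, x₃]` the chart function `A` and the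
Wronskian `A B' − A' B` do not vanish (graph-like arc); `H` vanishes at `x₁ < x₂ < x₃`.  Then the inflection determinant
`det[(A,B,H); (A',B',H'); (A'',B'',H'')]` vanishes at some `z ∈ (x₁, x₃)`. [folklore] -/
theorem exists_det3_eq_zero_of_three_zeros {A B H A' B' H' A'' B'' H'' : ℝ → ℝ} {x₁ x₂ x₃ : ℝ}
    (h12 : x₁ < x₂) (h23 : x₂ < x₃)
    (hA : ∀ x, HasDerivAt A (A' x) x) (hA' : ∀ x, HasDerivAt A' (A'' x) x)
    (hB : ∀ x, HasDerivAt B (B' x) x) (hB' : ∀ x, HasDerivAt B' (B'' x) x)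
    (hH : ∀ x, HasDerivAt H (H' x) x) (hH' : ∀ x, HasDerivAt H' (H'' x) x)
    (hA0 : ∀ x ∈ Icc x₁ x₃, A x ≠ 0) (hω : ∀ x ∈ Icc x₁ x₃, A x * B' x - A' x * B x ≠ 0)
    (h1 : H x₁ = 0) (h2 : H x₂ = 0) (h3 : H x₃ = 0) :
    ∃ z ∈ Ioo x₁ x₃,
      A z * (B' z * H'' z - H' z * B'' z) - B z * (A' z * H'' z - H' z * A'' z) + H z * (A' z * B'' z - B' z * A'' z) = 0 := by
  -- step 1: two zeros c₁ < c₂ of ω_H = A H' − A' H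
  obtain ⟨c₁, hc₁, hc₁0⟩ := exists_wronskian_eq_zero h12 hA hH
    (fun x hx => hA0 x ⟨hx.1, hx.2.trans h23.le⟩) h1 h2
  obtain ⟨c₂, hc₂, hc₂0⟩ := exists_wronskian_eq_zero h23 hA hH
    (fun x hx => hA0 x ⟨h12.le.trans hx.1, hx.2⟩) h2 h3
  have hc12 : c₁ < c₂ := hc₁.2.trans hc₂.1
  -- derivatives of ω = A B' − A' B and ω_H = A H' − A' H
  have hωd : ∀ x, HasDerivAt (fun y => A y * B' y - A' y * B y)
      (A' x * B' x + A x * B'' x - (A'' x * B x + A' x * B' x)) x :=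
    fun x => ((hA x).mul (hB' x)).sub ((hA' x).mul (hB x))
  have hωHd : ∀ x, HasDerivAt (fun y => A y * H' y - A' y * H y)
      (A' x * H' x + A x * H'' x - (A'' x * H x + A' x * H' x)) x :=
    fun x => ((hA x).mul (hH' x)).sub ((hA' x).mul (hH x))
  -- step 2: Rolle for the quotient ω_H / ω on [c₁, c₂]
  have hIcc : ∀ x ∈ Icc c₁ c₂, x ∈ Icc x₁ x₃ := fun x hx =>
    ⟨(hc₁.1.trans_le hx.1).le, hx.2.trans (hc₂.2.le)⟩
  obtain ⟨z, hz, hz0⟩ := exists_wronskian_eq_zero (A := fun y => A y * B' y - A' y * B y)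
    (H := fun y => A y * H' y - A' y * H y) hc12 hωd hωHd (fun x hx => hω x (hIcc x hx)) hc₁0 hc₂0
  refine ⟨z, ⟨hc₁.1.trans hz.1, hz.2.trans hc₂.2⟩, ?_⟩
  have hzI : z ∈ Icc x₁ x₃ := hIcc z (Ioo_subset_Icc_self hz)
  have hAz : A z ≠ 0 := hA0 z hzI
  -- the identity ω ω_H' − ω' ω_H = A · det
  have key : (A z * B' z - A' z * B z) * (A z * H'' z - A'' z * H z) -
      (A z * B'' z - A'' z * B z) * (A z * H' z - A' z * H z) = 0 := by
    have e1 : A' z * H' z + A z * H'' z - (A'' z * H z + A' z * H' z) = A z * H'' z - A'' z * H z := by ring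
    have e2 : A' z * B' z + A z * B'' z - (A'' z * B z + A' z * B' z) = A z * B'' z - A'' z * B z := by ring
    rw [e1, e2] at hz0
    linarith [hz0]
  rw [wronskian_identity] at key
  rcases mul_eq_zero.mp key with h | h
  · exact absurd h hAz
  · exact h

/-- **SECANCY–INFLECTION LEMMA (four points).**  Under the same graph-like hypotheses on `[x₁, x₄]`, four zeros
`x₁ < x₂ < x₃ < x₄` of `H` force TWO distinct zeros `z₁ < z₂` of the inflection determinant in `(x₁, x₄)`. [folklore] -/
theorem exists_two_det3_eq_zero_of_four_zeros {A B H A' B' H' A'' B'' H'' : ℝ → ℝ} {x₁ x₂ x₃ x₄ : ℝ}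
    (h12 : x₁ < x₂) (h23 : x₂ < x₃) (h34 : x₃ < x₄)
    (hA : ∀ x, HasDerivAt A (A' x) x) (hA' : ∀ x, HasDerivAt A' (A'' x) x)
    (hB : ∀ x, HasDerivAt B (B' x) x) (hB' : ∀ x, HasDerivAt B' (B'' x) x)
    (hH : ∀ x, HasDerivAt H (H' x) x) (hH' : ∀ x, HasDerivAt H' (H'' x) x)
    (hA0 : ∀ x ∈ Icc x₁ x₄, A x ≠ 0) (hω : ∀ x ∈ Icc x₁ x₄, A x * B' x - A' x * B x ≠ 0)
    (h1 : H x₁ = 0) (h2 : H x₂ = 0) (h3 : H x₃ = 0) (h4 : H x₄ = 0) :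
    ∃ z₁ ∈ Ioo x₁ x₄, ∃ z₂ ∈ Ioo x₁ x₄, z₁ < z₂ ∧
      A z₁ * (B' z₁ * H'' z₁ - H' z₁ * B'' z₁) - B z₁ * (A' z₁ * H'' z₁ - H' z₁ * A'' z₁) +
        H z₁ * (A' z₁ * B'' z₁ - B' z₁ * A'' z₁) = 0 ∧
      A z₂ * (B' z₂ * H'' z₂ - H' z₂ * B'' z₂) - B z₂ * (A' z₂ * H'' z₂ - H' z₂ * A'' z₂) +
        H z₂ * (A' z₂ * B'' z₂ - B' z₂ * A'' z₂) = 0 := by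
  -- three zeros c₁ < c₂ < c₃ of ω_H
  obtain ⟨c₁, hc₁, hc₁0⟩ := exists_wronskian_eq_zero h12 hA hH
    (fun x hx => hA0 x ⟨hx.1, hx.2.trans (h23.trans h34).le⟩) h1 h2
  obtain ⟨c₂, hc₂, hc₂0⟩ := exists_wronskian_eq_zero h23 hA hH
    (fun x hx => hA0 x ⟨h12.le.trans hx.1, hx.2.trans h34.le⟩) h2 h3
  obtain ⟨c₃, hc₃, hc₃0⟩ := exists_wronskian_eq_zero h34 hA hH
    (fun x hx => hA0 x ⟨(h12.trans h23).le.trans hx.1, hx.2⟩) h3 h4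
  have hc12 : c₁ < c₂ := hc₁.2.trans hc₂.1
  have hc23 : c₂ < c₃ := hc₂.2.trans hc₃.1
  have hωd : ∀ x, HasDerivAt (fun y => A y * B' y - A' y * B y)
      (A' x * B' x + A x * B'' x - (A'' x * B x + A' x * B' x)) x :=
    fun x => ((hA x).mul (hB' x)).sub ((hA' x).mul (hB x))
  have hωHd : ∀ x, HasDerivAt (fun y => A y * H' y - A' y * H y)
      (A' x * H' x + A x * H'' x - (A'' x * H x + A' x * H' x)) x :=
    fun x => ((hA x).mul (hH' x)).sub ((hA' x).mul (hH x))
  have hI12 : ∀ x ∈ Icc c₁ c₂, x ∈ Icc x₁ x₄ := fun x hx =>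
    ⟨(hc₁.1.trans_le hx.1).le, hx.2.trans (hc₂.2.trans h34).le⟩
  have hI23 : ∀ x ∈ Icc c₂ c₃, x ∈ Icc x₁ x₄ := fun x hx =>
    ⟨((h12.trans hc₂.1).trans_le hx.1).le, hx.2.trans hc₃.2.le⟩
  obtain ⟨z₁, hz₁, hz₁0⟩ := exists_wronskian_eq_zero (A := fun y => A y * B' y - A' y * B y)
    (H := fun y => A y * H' y - A' y * H y) hc12 hωd hωHd (fun x hx => hω x (hI12 x hx)) hc₁0 hc₂0
  obtain ⟨z₂, hz₂, hz₂0⟩ := exists_wronskian_eq_zero (A := fun y => A y * B' y - A' y * B y)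
    (H := fun y => A y * H' y - A' y * H y) hc23 hωd hωHd (fun x hx => hω x (hI23 x hx)) hc₂0 hc₃0
  have conclude : ∀ z ∈ Icc x₁ x₄,
      (A z * B' z - A' z * B z) * (A' z * H' z + A z * H'' z - (A'' z * H z + A' z * H' z)) -
        (A' z * B' z + A z * B'' z - (A'' z * B z + A' z * B' z)) * (A z * H' z - A' z * H z) = 0 →
      A z * (B' z * H'' z - H' z * B'' z) - B z * (A' z * H'' z - H' z * A'' z) +
        H z * (A' z * B'' z - B' z * A'' z) = 0 := by
    intro z hzI hz0
    have key : (A z * B' z - A' z * B z) * (A z * H'' z - A'' z * H z) -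
        (A z * B'' z - A'' z * B z) * (A z * H' z - A' z * H z) = 0 := by
      have e1 : A' z * H' z + A z * H'' z - (A'' z * H z + A' z * H' z) = A z * H'' z - A'' z * H z := by ring
      have e2 : A' z * B' z + A z * B'' z - (A'' z * B z + A' z * B' z) = A z * B'' z - A'' z * B z := by ring
      rw [e1, e2] at hz0
      linarith [hz0]
    rw [wronskian_identity] at key
    rcases mul_eq_zero.mp key with h | h
    · exact absurd h (hA0 z hzI)
    · exact h
  refine ⟨z₁, ⟨hc₁.1.trans hz₁.1, hz₁.2.trans (hc₂.2.trans h34)⟩,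
    z₂, ⟨(h12.trans hc₂.1).trans hz₂.1, hz₂.2.trans hc₃.2⟩, hz₁.2.trans hz₂.1, ?_, ?_⟩
  · exact conclude z₁ (hI12 z₁ (Ioo_subset_Icc_self hz₁)) hz₁0
  · exact conclude z₂ (hI23 z₂ (Ioo_subset_Icc_self hz₂)) hz₂0

/-! ### 3. Curves in `ℝ³`: collinear points on a graph-like arc force inflections -/

open Matrix

/-- **Change of functionals.**  For vectors `W₀, W₁, W₂ ∈ ℝ³` (a point of a curve and its first two derivatives) and functionals
`α, β, η ∈ ℝ³` (pairing = dot product), the determinant of the `3 × 3` array of pairings equals `det[α; β; η] · det[W₀; W₁; W₂]`.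
In particular its vanishing does not depend on the (invertible) choice of functionals: it is the INFLECTION condition
`det(W, W', W'') = 0`. [folklore] -/
theorem det3_pairings_eq (α β η W₀ W₁ W₂ : Fin 3 → ℝ) :
    (α ⬝ᵥ W₀) * ((β ⬝ᵥ W₁) * (η ⬝ᵥ W₂) - (η ⬝ᵥ W₁) * (β ⬝ᵥ W₂)) -
        (β ⬝ᵥ W₀) * ((α ⬝ᵥ W₁) * (η ⬝ᵥ W₂) - (η ⬝ᵥ W₁) * (α ⬝ᵥ W₂)) +
        (η ⬝ᵥ W₀) * ((α ⬝ᵥ W₁) * (β ⬝ᵥ W₂) - (β ⬝ᵥ W₁) * (α ⬝ᵥ W₂)) =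
      Matrix.det (Matrix.of ![α, β, η]) * Matrix.det (Matrix.of ![W₀, W₁, W₂]) := by
  simp only [Matrix.det_fin_three, dotProduct, Fin.sum_univ_three, Matrix.of_apply, Matrix.cons_val_zero,
    Matrix.cons_val_one, Matrix.cons_val_two, Matrix.head_cons, Matrix.tail_cons]
  ring

/-- Derivative of a pairing `x ↦ α ⬝ᵥ W(x)` from the componentwise derivatives. [folklore] -/
theorem hasDerivAt_dotProduct {W W' : ℝ → Fin 3 → ℝ} (α : Fin 3 → ℝ) (x : ℝ)
    (hW : ∀ i, HasDerivAt (fun y => W y i) (W' x i) x) :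
    HasDerivAt (fun y => α ⬝ᵥ W y) (α ⬝ᵥ W' x) x := by
  have : HasDerivAt (fun y => ∑ i, α i * W y i) (∑ i, α i * W' x i) x :=
    HasDerivAt.fun_sum fun i _ => (hW i).const_mul (α i)
  simpa [dotProduct] using this

/-- **Three collinear points on a graph-like arc force an inflection.**  Let `W : ℝ → ℝ³` be a curve with componentwise first and
second derivatives `W', W''` (everywhere), and `α, β, η ∈ ℝ³` independent functionals (`det[α;β;η] ≠ 0`).  Suppose that on
`[x₁, x₃]` the chart functional `α·W` and the Wronskian `(α·W)(β·W)' − (α·W)'(β·W)` do not vanish (the arc is the graph of a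
function of the monotone affine coordinate `β·W/α·W`), and that the arc meets the line `{η = 0}` at `x₁ < x₂ < x₃`.  Then
`det(W, W', W'')` vanishes at some `z ∈ (x₁, x₃)`: the arc has an INFLECTION between the three collinear points. [folklore] -/
theorem exists_inflection_of_three_collinear {W W' W'' : ℝ → Fin 3 → ℝ} (α β η : Fin 3 → ℝ) {x₁ x₂ x₃ : ℝ}
    (h12 : x₁ < x₂) (h23 : x₂ < x₃)
    (hW : ∀ i x, HasDerivAt (fun y => W y i) (W' x i) x) (hW' : ∀ i x, HasDerivAt (fun y => W' y i) (W'' x i) x)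
    (hL : Matrix.det (Matrix.of ![α, β, η]) ≠ 0)
    (hA0 : ∀ x ∈ Icc x₁ x₃, α ⬝ᵥ W x ≠ 0)
    (hω : ∀ x ∈ Icc x₁ x₃, (α ⬝ᵥ W x) * (β ⬝ᵥ W' x) - (α ⬝ᵥ W' x) * (β ⬝ᵥ W x) ≠ 0)
    (h1 : η ⬝ᵥ W x₁ = 0) (h2 : η ⬝ᵥ W x₂ = 0) (h3 : η ⬝ᵥ W x₃ = 0) :
    ∃ z ∈ Ioo x₁ x₃, Matrix.det (Matrix.of ![W z, W' z, W'' z]) = 0 := by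
  obtain ⟨z, hz, hdet⟩ := exists_det3_eq_zero_of_three_zeros (A := fun y => α ⬝ᵥ W y) (B := fun y => β ⬝ᵥ W y)
    (H := fun y => η ⬝ᵥ W y) (A' := fun y => α ⬝ᵥ W' y) (B' := fun y => β ⬝ᵥ W' y) (H' := fun y => η ⬝ᵥ W' y)
    (A'' := fun y => α ⬝ᵥ W'' y) (B'' := fun y => β ⬝ᵥ W'' y) (H'' := fun y => η ⬝ᵥ W'' y) h12 h23
    (fun x => hasDerivAt_dotProduct α x fun i => hW i x) (fun x => hasDerivAt_dotProduct α x fun i => hW' i x)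
    (fun x => hasDerivAt_dotProduct β x fun i => hW i x) (fun x => hasDerivAt_dotProduct β x fun i => hW' i x)
    (fun x => hasDerivAt_dotProduct η x fun i => hW i x) (fun x => hasDerivAt_dotProduct η x fun i => hW' i x)
    hA0 hω h1 h2 h3
  refine ⟨z, hz, ?_⟩
  rw [det3_pairings_eq] at hdet
  rcases mul_eq_zero.mp hdet with h | h
  · exact absurd h hL
  · exact h

/-- **Four collinear points on a graph-like arc force two inflections** (same hypotheses on `[x₁, x₄]`). [folklore] -/
theorem exists_two_inflections_of_four_collinear {W W' W'' : ℝ → Fin 3 → ℝ} (α β η : Fin 3 → ℝ) {x₁ x₂ x₃ x₄ : ℝ}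
    (h12 : x₁ < x₂) (h23 : x₂ < x₃) (h34 : x₃ < x₄)
    (hW : ∀ i x, HasDerivAt (fun y => W y i) (W' x i) x) (hW' : ∀ i x, HasDerivAt (fun y => W' y i) (W'' x i) x)
    (hL : Matrix.det (Matrix.of ![α, β, η]) ≠ 0)
    (hA0 : ∀ x ∈ Icc x₁ x₄, α ⬝ᵥ W x ≠ 0)
    (hω : ∀ x ∈ Icc x₁ x₄, (α ⬝ᵥ W x) * (β ⬝ᵥ W' x) - (α ⬝ᵥ W' x) * (β ⬝ᵥ W x) ≠ 0)
    (h1 : η ⬝ᵥ W x₁ = 0) (h2 : η ⬝ᵥ W x₂ = 0) (h3 : η ⬝ᵥ W x₃ = 0) (h4 : η ⬝ᵥ W x₄ = 0) :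
    ∃ z₁ ∈ Ioo x₁ x₄, ∃ z₂ ∈ Ioo x₁ x₄, z₁ < z₂ ∧
      Matrix.det (Matrix.of ![W z₁, W' z₁, W'' z₁]) = 0 ∧ Matrix.det (Matrix.of ![W z₂, W' z₂, W'' z₂]) = 0 := by
  obtain ⟨z₁, hz₁, z₂, hz₂, hlt, hd₁, hd₂⟩ := exists_two_det3_eq_zero_of_four_zeros (A := fun y => α ⬝ᵥ W y)
    (B := fun y => β ⬝ᵥ W y) (H := fun y => η ⬝ᵥ W y) (A' := fun y => α ⬝ᵥ W' y) (B' := fun y => β ⬝ᵥ W' y)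
    (H' := fun y => η ⬝ᵥ W' y) (A'' := fun y => α ⬝ᵥ W'' y) (B'' := fun y => β ⬝ᵥ W'' y) (H'' := fun y => η ⬝ᵥ W'' y)
    h12 h23 h34
    (fun x => hasDerivAt_dotProduct α x fun i => hW i x) (fun x => hasDerivAt_dotProduct α x fun i => hW' i x)
    (fun x => hasDerivAt_dotProduct β x fun i => hW i x) (fun x => hasDerivAt_dotProduct β x fun i => hW' i x)
    (fun x => hasDerivAt_dotProduct η x fun i => hW i x) (fun x => hasDerivAt_dotProduct η x fun i => hW' i x)
    hA0 hω h1 h2 h3 h4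
  refine ⟨z₁, hz₁, z₂, hz₂, hlt, ?_, ?_⟩
  · rw [det3_pairings_eq] at hd₁
    rcases mul_eq_zero.mp hd₁ with h | h
    · exact absurd h hL
    · exact h
  · rw [det3_pairings_eq] at hd₂
    rcases mul_eq_zero.mp hd₂ with h | h
    · exact absurd h hL
    · exact h

/-! ### 4. Link with the inflection fewnomial `det[W; θW; θ²W]` of `…DoorA26GraftInflectionBudget` -/

/-- **Euler rows versus derivatives.**  At a point `z`, the rows `(W, θW, θ²W) = (W, z W', z² W'' + z W')` have determinant
`z³ · det(W, W', W'')`; so for `z > 0` the inflection fewnomial of p689485 vanishes exactly at the inflections `det(W,W',W'') = 0`.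
[folklore] -/
theorem det_eulerRows_eq (z : ℝ) (W₀ W₁ W₂ : Fin 3 → ℝ) :
    Matrix.det (Matrix.of ![W₀, z • W₁, z ^ 2 • W₂ + z • W₁]) = z ^ 3 * Matrix.det (Matrix.of ![W₀, W₁, W₂]) := by
  simp only [Matrix.det_fin_three, Matrix.of_apply, Matrix.cons_val_zero, Matrix.cons_val_one, Matrix.cons_val_two,
    Matrix.head_cons, Matrix.tail_cons, Pi.add_apply, Pi.smul_apply, smul_eq_mul]
  ring

/-- **Evaluation of the inflection fewnomial.**  Evaluating the polynomial `det[ Σ_l C(d_l^r v_{l,a}) X^{d_l} ]_{r,a}` of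
`…DoorA26GraftInflectionBudget` at `z` gives the determinant of the EULER ROWS `Σ_l d_l^r v_{l,a} z^{d_l}` (`r = 0,1,2`) of the letter
curve at `z` (evaluation is a ring morphism, `RingHom.map_det`). [folklore] -/
theorem eval_det_inflMatrix {K : ℕ} (d : Fin K → ℕ) (v : Fin K → Fin 3 → ℝ) (z : ℝ) :
    (Matrix.det (Matrix.of fun (r : Fin 3) (a : Fin 3) =>
        ∑ l, Polynomial.C (((d l : ℝ) ^ (r : ℕ)) * v l a) * Polynomial.X ^ (d l))).eval z =
      Matrix.det (Matrix.of fun (r : Fin 3) (a : Fin 3) => ∑ l, ((d l : ℝ) ^ (r : ℕ)) * v l a * z ^ (d l)) := by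
  rw [← Polynomial.coe_evalRingHom, RingHom.map_det]
  congr 1
  ext r a
  simp [Polynomial.eval_finsetSum]

end Summit.ValiantsHypothesis.ValiantsHypothesis.Theorems.LacunarySymmetroid.DoorA26.Inflection
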